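import Summits.Ventures.QEDPrecision.Diagrams.VolkovTables2018

/-!
Venture QEDPrecision / cell `pub-qed`, unit `pub-qed-int-2` (INT-2, gen 8). HONEST FRAMING: independent recomputation;
certified where stated, statistical where stated; no new-physics claim.  NEW WORK of the cell (a kernel-checked audit / formal
identity), not a published result: nothing here is cited as a fact anywhere; the printed sources are named only in comments.
Staged copy: HOME/lean/int2/VolkovOnShellSets.lean (declarations byte-identical).

# Volkov's subtraction versus on-shell renormalisation, graph set by graph set: a formal model in which every printed set of
# PRD 98, 076018 closes

S. Volkov computes the contributions without lepton loops to the electron anomaly graph by graph with his own forest formula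
[arXiv:1507.06435 §2; 1705.05800 §II; 1807.05281 §II — `R^new_G` of `VolkovForestTerms`]: operators `A` (anomaly projector),
`U` (`UΓ_μ = a(m²)γ_μ` on vertex-like, `UΣ = u(m²) + v(m²)p̂` on self-energy-like subgraphs — "it differs from the standard
on-shell renormalization"), `L` (on-shell vertex condition `[a + m b + m² c](m²)γ_μ`), `L − U`.  Graph values are therefore
scheme-bound; the paper prints the sets of graphs on which the total "must coincide with the direct subtraction on the mass
shell", says this "can be proved in a combinatorial way" with the Ward identity, and works the 3-loop example {26, 27}; no
derivation of the sets is printed (tables: `VolkovTables2018`).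
THE MODEL (§1).  Both renormalisations are forest formulas over the same forests (laminar families of UV-divergent segments,
`VolkovForests`, `subForests`): on-shell puts `T_Σ = δm + B'·(p̂ − m)` on self-energy-like and `L` on vertex-like members
(`A(1 − L_G) = A` on the whole graph); Volkov's puts the operators of `R^new` (one term per `G' ∈ 𝕴[G] ∩ F`, `opOf`).  Each
operator replaces a member (its sub-members already replaced) by a NUMBER times a local structure: a vertex-like member becomes a
point vertex keeping its photon leg, times `A'`, `L'` or `U'` of its REDUCED GRAPH; a self-energy-like member becomes EITHER a
mass point times `δm'` (the same number for `U` and `T`: both agree at `p̂ = m`) OR — through `c·(p̂ − m)` cancelling one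
adjacent propagator, `(p̂ − m)·i(p̂ + m)/(p² − m²) = i` — a merging of its two adjacent lines times `i c`, `c = U'_Σ = v(m²)` resp.
`c = B' = (v + 2m u' + 2m² v')(m²)`.  So every forest term, projected by `A`, is ± a MONOMIAL in symbols `O'[g]` (an operator
value of a reduced graph `g`; graphs up to path reversal, mirror images having equal values), summed over the parts chosen in
the self-energy-like members.  Reduced graphs are words in {0 = external/leg vertex, 1 = mass point, photon letters}
(`slotWord`, `reducedWord`, `canonKey`).  The ONLY relations used are the WARD IDENTITIES of each self-energy-like reduced
graph `s` (lines `1 … k`; `v_i(s)` = `s` with a zero-momentum photon vertex in line `i`): `Σ_i Λ^{(i)}_μ(p,0) = −i ∂Σ_s/∂p^μ`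
(differentiate the propagators; point insertions are constants), i.e. on the form factors `Σ = u + v p̂`,
`Λ = aγ_μ + b p_μ + c p̂p_μ + d(p̂γ_μ − γ_μp̂)`: `Σ_i a_i = −i v`, `Σ_i b_i = −2i u'`, `Σ_i c_i = −2i v'`, hence
`Σ_i L'[v_i(s)] = −i B'[s]` (`Z₁ = Z₂`) and, for Volkov's `U`, `Σ_i U'[v_i(s)] = −i U'_Σ[s]` ("U preserves the Ward identity").
They are substituted at once (`seAlts`: `i B' ↦ −Σ_i L'[v_i]`, `i U'_Σ ↦ −Σ_i U'[v_i]`), and `U' = L' − D'` on vertex-like graphs;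
the remaining symbols `A'`, `L'`, `D'`, `δm'` are INDEPENDENT indeterminates.  `diffPoly` = the integer polynomial
`R^Volkov − R^on-shell` of a directed graph; `rowResidual` = multiplicity (1 for a mirror-symmetric graph, else 2) × `diffPoly` of
the printed orientation — the orbit sum, because the mirror graph expanded through ITS OWN forests gives the same polynomial
(`mirrorInvariant_*`: certified for all 4 + 28 + 269 rows); a set of rows `closes` when the sum vanishes identically.
CERTIFIED (§2; kernel `decide` only): every one of the 3 + 11 + 78 printed sets closes (`volkovSets_close_*`; 4 loops in
kernel-sized chunks joined by `List.all_append`); explicitly, 2-loop rows 1 / 2 have residuals `± 2·A'[V₁]·D'[V₁]` and rows 3, 4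
zero (`order4_residuals`), and the paper's example: rows 26 / 27 of the 3-loop table have residuals `±(A'[C₂]D'[V₁] − A'[V₁]D'[C₂])`
(`V₁ = [2,0,2]` the one-loop vertex, `C₂ = [2,3,0,2,3]` the crossed two-loop vertex) — they close together, not alone, with no
Ward identity needed (`order6_example_26_27`).  Minimality (no proper non-empty subset of a printed set closes) and "the rows
closing alone are exactly the single-graph sets" are in `VolkovOnShellSetsMinimal`.
NOT CLAIMED. The model is formal: operator values are indeterminates; regularisation and the infrared structure of individual
terms are not modelled (the paper itself adds "if we do not consider the matter of divergence regularizations"); mirror-equality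
of operator values and the two Ward identities are the physics input, stated not proved; no number of the paper is used.
Two implementations (cell habit): the unit's `formal.py` (symbolic tuples, Ward identities eliminated after expansion) and these
functions (numeric keys, substitution at generation; transliterated in `lean_mirror.py`) agree on every residual
(HOME/lean/int2/onshell_sets/); the kernel is the judge of the statements below.
-/

namespace Summit.Ventures.QEDPrecision.Diagrams

/-! ## 1. The formal model: both forest formulas as polynomials in operator values of reduced graphs -/

/-- photon number of the path point `p`: the position in `M` of the pair containing it (`M.length` if unmatched). -/
def photonIdx : List (ℕ × ℕ) → ℕ → ℕ
  | [], _ => 0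
  | e :: t, p => if e.1 == p || e.2 == p then 0 else photonIdx t p + 1

/-- the SLOT WORD of a vertex graph: path point `p ↦ 0` if `p` is the external vertex, else `2 +` its photon number.  Reduced
graphs below are words in the same alphabet, with `1` = a mass-insertion point (and photon numbers need not be contiguous);
a word containing `0` is vertex-like (the `0` is the vertex of its photon leg), a word without `0` is self-energy-like. -/
def slotWord (N X : ℕ) (M : List (ℕ × ℕ)) : List ℕ := (List.range N).map (fun p => if p == X then 0 else photonIdx M p + 2)

/-- relabel the photon letters (`≥ 2`) of a word by first occurrence (`2, 3, …`); `0` and `1` are kept. -/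
def relabelAux : List ℕ → List (ℕ × ℕ) → ℕ → List ℕ
  | [], _, _ => []
  | c :: t, tbl, nx =>
      if Nat.blt c 2 then c :: relabelAux t tbl nx else
      match tbl.find? (fun q => q.1 == c) with
      | some q => q.2 :: relabelAux t tbl nx
      | none => nx :: relabelAux t ((c, nx) :: tbl) (nx + 1)

/-- canonical relabelling of a word. -/
def relabel (w : List ℕ) : List ℕ := relabelAux w [] 2

/-- a word over `{0, …, 14}` as one natural number (base 16, digits shifted by one). -/
def encodeWord (w : List ℕ) : ℕ := w.foldl (fun acc d => acc * 16 + (d + 1)) 0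

/-- canonical KEY of a reduced graph up to path reversal: the smaller relabelled word of the two orientations, encoded.
(The operator values `A'`, `L'`, `U'`, `δm'`, `B'` of a graph and of its mirror image coincide, so symbols are indexed by
orbits.) -/
def canonKey (w : List ℕ) : ℕ :=
  let a := relabel w
  let b := relabel w.reverse
  if lexLE a b then encodeWord a else encodeWord b

/-- a SYMBOL = (operator value, reduced graph): `s * 2^40 + key`, `s` = 1 for `A'`, 2 for `L'`, 3 for `D' := L' − U'`
(vertex-like graphs), 4 for `δm'` (self-energy-like graphs).  (`B'` and `U'_Σ` of self-energy-like graphs never appear: they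
are rewritten by the Ward identities at once, see `seAlts`.) -/
def sym (s key : ℕ) : ℕ := s * 1099511627776 + key

/-- a MONOMIAL (a multiset of symbols) as one natural number: sorted, base `2^48`, digits shifted by one. -/
def monoKey (l : List ℕ) : ℕ := (sortNat l).foldl (fun acc c => acc * 281474976710656 + (c + 1)) 0

/-- add `c ·(monomial k)` to a polynomial = list of (monomial, coefficient) increasing in the monomial, no zero coefficient. -/
def pins (k : ℕ) (c : ℤ) : List (ℕ × ℤ) → List (ℕ × ℤ)
  | [] => if c == 0 then [] else [(k, c)]
  | q :: t =>
      if Nat.blt k q.1 then (if c == 0 then q :: t else (k, c) :: q :: t)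
      else if k == q.1 then (if c + q.2 == 0 then t else (k, c + q.2) :: t)
      else q :: pins k c t

/-- sum of two polynomials. -/
def padd (p q : List (ℕ × ℤ)) : List (ℕ × ℤ) := p.foldr (fun m acc => pins m.1 m.2 acc) q

/-- the members of the forest `F` that are maximal strictly inside the segment `seg`. -/
def kidsOf (seg : ℕ × ℕ) (F : List (ℕ × ℕ)) : List (ℕ × ℕ) :=
  let inner := F.filter (fun c => segStrictSub c seg)
  inner.filter (fun c => !(inner.any (fun d => segStrictSub c d)))

/-- all ways of choosing one element from each list. -/
def cartesian {α : Type} : List (List α) → List (List α)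
  | [] => [[]]
  | l :: t => let ct := cartesian t; l.foldr (fun a acc => ct.map (fun rest => a :: rest) ++ acc) []

/-- the REDUCED WORD of the piece `seg`: the letters of the slot word `w` at the points of `seg`, each chosen maximal
sub-member `(kid, r)` replaced by nothing (`r = 0`: a self-energy-like member taken with its `(p̂ − m)`-proportional part,
which cancels one adjacent propagator and merges the two adjacent lines) or by the single letter `r - 1` (`1` = a mass point
for the `δm` part of a self-energy-like member; the letter of its photon leg for a vertex-like member, `0` if that leg is the
external photon). -/
def reducedWord (w : List ℕ) (seg : ℕ × ℕ) (chosen : List ((ℕ × ℕ) × ℕ)) : List ℕ :=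
  ((List.range w.length).zip w).foldr (fun pv acc =>
    if !(inSeg seg.1 seg.2 pv.1) then acc else
    match chosen.find? (fun cr => inSeg cr.1.1 cr.1.2 pv.1) with
    | none => pv.2 :: acc
    | some cr => if pv.1 == cr.1.1 then (if cr.2 == 0 then acc else (cr.2 - 1) :: acc) else acc) []

/-- photon number of the (first) photon with exactly one end in the segment `[i, j]`. -/
def legIdx (i j : ℕ) : List (ℕ × ℕ) → ℕ
  | [] => 0
  | e :: t => if inSeg i j e.1 != inSeg i j e.2 then 0 else legIdx i j t + 1

/-- the word `red` with the external vertex `0` inserted into its `i`-th line (between letters `i` and `i+1`), all `i`. -/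
def insertions (red : List ℕ) : List (List ℕ) :=
  (List.range (red.length - 1)).map (fun i => red.take (i + 1) ++ 0 :: red.drop (i + 1))

/-- ALTERNATIVES `(coefficient, symbols, replacement letter + 1)` contributed by a vertex-like piece with reduced-graph key
`key` under the operator with code `o`: 0 = `A` ↦ `A'`; 1 = `L` ↦ `L'`; 2 = `L − U` ↦ `D'`; 3 = `U` ↦ `L' − D'`. -/
def vertexAlts (o key : ℕ) (coeff : ℤ) (syms : List ℕ) (rep : ℕ) : List (ℤ × List ℕ × ℕ) :=
  if o == 0 then [(coeff, sym 1 key :: syms, rep)]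
  else if o == 1 then [(coeff, sym 2 key :: syms, rep)]
  else if o == 2 then [(coeff, sym 3 key :: syms, rep)]
  else [(coeff, sym 2 key :: syms, rep), (-coeff, sym 3 key :: syms, rep)]

/-- ALTERNATIVES contributed by a self-energy-like piece with reduced word `red` under the operator with code `o`
(4 = Volkov's `U`, 5 = the on-shell subtraction `T`).  Both have the mass part `δm'[red]` (the same number: `UΣ(p)` and `TΣ(p)`
agree at `p̂ = m`), leaving a mass point; and a part `c · (p̂ − m)` merging the adjacent lines, `c = U'_Σ := v(m²)` for `U`
(`Σ = u(p²) + v(p²) p̂`) and `c = B' := v(m²) + 2m u'(m²) + 2m² v'(m²)` for `T`, times the propagator-cancellation factor `i`.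
These are rewritten AT ONCE by the Ward identities of `red` (zero-momentum insertion of the photon leg into each of its
electron lines, `Σ_i Λ^{(i)}_μ(p, 0) = −i ∂Σ/∂p^μ`, which for the form factors gives `Σ_i L'[v_i] = −i B'` and, with
Volkov's `UΓ_μ = a(m²)γ_μ`, `Σ_i U'[v_i] = −i U'_Σ`):  `i B' ↦ −Σ_i L'[v_i]`,  `i U'_Σ ↦ −Σ_i U'[v_i] = −Σ_i (L' − D')[v_i]`. -/
def seAlts (o : ℕ) (red : List ℕ) (coeff : ℤ) (syms : List ℕ) : List (ℤ × List ℕ × ℕ) :=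
  (coeff, sym 4 (canonKey red) :: syms, 2) ::
    (insertions red).foldr (fun v acc =>
      (if o == 5 then [(-coeff, sym 2 (canonKey v) :: syms, 0)]
       else [(-coeff, sym 2 (canonKey v) :: syms, 0), (coeff, sym 3 (canonKey v) :: syms, 0)]) ++ acc) []

/-- ALTERNATIVES `(coefficient, symbols of the piece and of everything inside it, replacement letter + 1 (0 = merge))` of the
piece `seg` of the graph with slot word `w`, external vertex `X`, photons `M`, in the forest `F` (root included) under the
operator assignment `op` (codes as in `vertexAlts` / `seAlts`); structural recursion on the fuel = nesting depth allowed. -/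
def pieceAlts : ℕ → List ℕ → ℕ → List (ℕ × ℕ) → List (ℕ × ℕ) → (ℕ × ℕ → ℕ) → ℕ × ℕ → List (ℤ × List ℕ × ℕ)
  | 0, _, _, _, _, _, _ => []
  | fuel + 1, w, X, M, F, op, seg =>
      let kids := kidsOf seg F
      let kidAlts := kids.map (fun c => (pieceAlts fuel w X M F op c).map (fun a => (c, a)))
      (cartesian kidAlts).foldr (fun choice acc =>
        let coeff : ℤ := choice.foldr (fun ca r => ca.2.1 * r) 1
        let syms : List ℕ := choice.foldr (fun ca r => ca.2.2.1 ++ r) []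
        let red := reducedWord w seg (choice.map (fun ca => (ca.1, ca.2.2.2)))
        (if inSeg seg.1 seg.2 X then vertexAlts (op seg) (canonKey red) coeff syms 1
         else if segPhotonLegs X seg.1 seg.2 M == 0 then seAlts (op seg) red coeff syms
         else
           let leg := legIdx seg.1 seg.2 M + 2
           vertexAlts (op seg) (canonKey (red.map (fun c => if c == leg then 0 else c))) coeff syms (leg + 1)) ++ acc) []

/-- accumulate `sign ·` the monomials of a term into a polynomial. -/
def termPoly (alts : List (ℤ × List ℕ × ℕ)) (sign : ℤ) (acc : List (ℕ × ℤ)) : List (ℕ × ℤ) :=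
  alts.foldr (fun a r => pins (monoKey a.2.1) (sign * a.1) r) acc

/-- `R^Volkov_G − R^on-shell_G` of a (directed) vertex graph with `n` internal photons, projected by `A`, as a polynomial in
the symbols, the Ward identities already used: over the forests `F ∋ G` (`subForests (properUV …)` = `F ∖ {G}`, sign
`(−1)^{|F|−1}`): the on-shell term puts `A` on `G`, `T` on self-energy-like and `L` on vertex-like members; Volkov's terms, one
per `G' ∈ 𝕴[G] ∩ F`, put the operators of `opOf` (`A` on `G'`; `L − U` on `G ≠ G'`; `U` on members outside `𝕴` or inside `G'`;
`L` on members of `𝕴` strictly containing `G'`). -/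
def diffPoly (n : ℕ) (M : List (ℕ × ℕ)) : List (ℕ × ℤ) :=
  let N := 2 * n + 1
  let X := extVertex N M
  let w := slotWord N X M
  let root : ℕ × ℕ := (0, N - 1)
  (subForests (properUV N X M) []).foldr (fun sub acc =>
    let sign : ℤ := if sub.length % 2 == 0 then 1 else -1
    let F := root :: sub
    let isS : ℕ × ℕ → Bool := fun c => !(inSeg c.1 c.2 X) && segPhotonLegs X c.1 c.2 M == 0
    let opO : ℕ × ℕ → ℕ := fun c => if segEq c root then 0 else if isS c then 5 else 1
    let acc1 := termPoly (pieceAlts (n + 1) w X M F opO root) (-sign) acc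
    (F.filter (isIType X)).foldr (fun Gp acc2 =>
      let opV : ℕ × ℕ → ℕ := fun c =>
        if segEq c Gp then 0 else if segEq c root then 2 else if isS c then 4
        else if isIType X c && segStrictSub Gp c then 1 else 3
      termPoly (pieceAlts (n + 1) w X M F opV root) sign acc2) acc1) []

/-- multiplicity of printed row `i`: 1 if its graph is its own mirror image, else 2 (the row stands for both orientations,
which have equal values). -/
def rowMult (n : ℕ) (rows : List (ℕ × List (ℕ × ℕ))) (i : ℕ) : ℤ :=
  if mirrorGraph (2 * n + 1) (graphAt rows i) == graphAt rows i then 1 else 2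

/-- a polynomial times a non-zero integer. -/
def pscale (c : ℤ) (P : List (ℕ × ℤ)) : List (ℕ × ℤ) := P.map (fun q => (q.1, c * q.2))

/-- the RESIDUAL of printed row `i`: multiplicity × `diffPoly` of the printed orientation.  (The mirror orientation carries the
mirror-image polynomial, which is the same polynomial under the model's identification of mirror-image reduced graphs —
`mirrorInvariant`, certified row by row below — so this is the orbit sum.) -/
def rowResidual (n : ℕ) (rows : List (ℕ × List (ℕ × ℕ))) (i : ℕ) : List (ℕ × ℤ) :=
  pscale (rowMult n rows i) (diffPoly n (graphAt rows i))

/-- the model is covariant under path reversal at printed row `i`: the mirror graph, expanded through ITS OWN forests and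
terms, has the same difference polynomial. -/
def mirrorInvariant (n : ℕ) (rows : List (ℕ × List (ℕ × ℕ))) (i : ℕ) : Bool :=
  diffPoly n (mirrorGraph (2 * n + 1) (graphAt rows i)) == diffPoly n (graphAt rows i)

/-- residual of a set of rows. -/
def blockResidual (n : ℕ) (rows : List (ℕ × List (ℕ × ℕ))) (b : List ℕ) : List (ℕ × ℤ) :=
  b.foldr (fun i acc => padd (rowResidual n rows i) acc) []

/-- the set of rows CLOSES: the Volkov-subtracted and the on-shell-subtracted sums over it agree identically in the operator
values, given the Ward identities. -/
def closes (n : ℕ) (rows : List (ℕ × List (ℕ × ℕ))) (b : List ℕ) : Bool := (blockResidual n rows b).isEmpty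

/-! ## 2. Theorems -/

/-- the model is reversal-covariant on every printed row, 2 and 3 loops. -/
theorem mirrorInvariant_orders_4_6 :
    (List.range' 1 4).all (mirrorInvariant 2 printedRows2) = true ∧
      (List.range' 1 28).all (mirrorInvariant 3 printedRows3) = true := by
  refine ⟨?_, ?_⟩ <;> decide +kernel

set_option maxHeartbeats 4000000 in
set_option maxRecDepth 40000 in
/-- reversal covariance, 4 loops, rows 1–27. -/
theorem mirrorInvariant_order8_a : (List.range' 1 27).all (mirrorInvariant 4 printedRows4) = true := by
  decide +kernel

set_option maxHeartbeats 4000000 in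
set_option maxRecDepth 40000 in
/-- reversal covariance, 4 loops, rows 28–54. -/
theorem mirrorInvariant_order8_b : (List.range' 28 27).all (mirrorInvariant 4 printedRows4) = true := by
  decide +kernel

set_option maxHeartbeats 4000000 in
set_option maxRecDepth 40000 in
/-- reversal covariance, 4 loops, rows 55–81. -/
theorem mirrorInvariant_order8_c : (List.range' 55 27).all (mirrorInvariant 4 printedRows4) = true := by
  decide +kernel

set_option maxHeartbeats 4000000 in
set_option maxRecDepth 40000 in
/-- reversal covariance, 4 loops, rows 82–108. -/
theorem mirrorInvariant_order8_d : (List.range' 82 27).all (mirrorInvariant 4 printedRows4) = true := by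
  decide +kernel

set_option maxHeartbeats 4000000 in
set_option maxRecDepth 40000 in
/-- reversal covariance, 4 loops, rows 109–135. -/
theorem mirrorInvariant_order8_e : (List.range' 109 27).all (mirrorInvariant 4 printedRows4) = true := by
  decide +kernel

set_option maxHeartbeats 4000000 in
set_option maxRecDepth 40000 in
/-- reversal covariance, 4 loops, rows 136–162. -/
theorem mirrorInvariant_order8_f : (List.range' 136 27).all (mirrorInvariant 4 printedRows4) = true := by
  decide +kernel

set_option maxHeartbeats 4000000 in
set_option maxRecDepth 40000 in
/-- reversal covariance, 4 loops, rows 163–189. -/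
theorem mirrorInvariant_order8_g : (List.range' 163 27).all (mirrorInvariant 4 printedRows4) = true := by
  decide +kernel

set_option maxHeartbeats 4000000 in
set_option maxRecDepth 40000 in
/-- reversal covariance, 4 loops, rows 190–216. -/
theorem mirrorInvariant_order8_h : (List.range' 190 27).all (mirrorInvariant 4 printedRows4) = true := by
  decide +kernel

set_option maxHeartbeats 4000000 in
set_option maxRecDepth 40000 in
/-- reversal covariance, 4 loops, rows 217–243. -/
theorem mirrorInvariant_order8_i : (List.range' 217 27).all (mirrorInvariant 4 printedRows4) = true := by
  decide +kernel

set_option maxHeartbeats 4000000 in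
set_option maxRecDepth 40000 in
/-- reversal covariance, 4 loops, rows 244–269. -/
theorem mirrorInvariant_order8_j : (List.range' 244 26).all (mirrorInvariant 4 printedRows4) = true := by
  decide +kernel

/-- The model at two loops, row by row: rows 1 (`2; 1-4, 3-5`, a vertex-like subgraph not containing the external vertex) and 2
(`2; 1-5, 3-4`, a self-energy insertion) have the residuals `+2·A'[V₁]·D'[V₁]` and `−2·A'[V₁]·D'[V₁]` (the factor 2 = the two
orientations; `V₁ = [2,0,2]` the one-loop vertex; row 2's `−2i·A'[V₁]·(B' − U'_Σ)[one-loop Σ]` rewritten by the Ward identity),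
rows 3 (crossed) and 4 (ladder: `A'[V₁]D'[V₁] − D'[V₁]A'[V₁]`) have residual zero. -/
theorem order4_residuals :
    rowResidual 2 printedRows2 1 = [(monoKey [sym 1 (canonKey [2, 0, 2]), sym 3 (canonKey [2, 0, 2])], 2)] ∧
    rowResidual 2 printedRows2 2 = [(monoKey [sym 1 (canonKey [2, 0, 2]), sym 3 (canonKey [2, 0, 2])], -2)] ∧
    rowResidual 2 printedRows2 3 = [] ∧ rowResidual 2 printedRows2 4 = [] := by
  refine ⟨?_, ?_, ?_, ?_⟩ <;> decide +kernel

/-- The paper's worked example (3 loops, rows 26 `4; 1-6, 2-7, 3-5` and 27 `4; 1-7, 2-5, 3-6`): residuals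
`A'[C₂]·D'[V₁] − A'[V₁]·D'[C₂]` and its negative (`C₂ = [2,3,0,2,3]` the crossed two-loop vertex), so the pair closes and
neither graph alone does; row 28 (`4; 1-7, 2-6, 3-5`, nested) closes alone. -/
theorem order6_example_26_27 :
    rowResidual 3 printedRows3 26 =
      padd [(monoKey [sym 1 (canonKey [2, 3, 0, 2, 3]), sym 3 (canonKey [2, 0, 2])], 1)]
        [(monoKey [sym 1 (canonKey [2, 0, 2]), sym 3 (canonKey [2, 3, 0, 2, 3])], -1)] ∧
    rowResidual 3 printedRows3 27 =
      padd [(monoKey [sym 1 (canonKey [2, 3, 0, 2, 3]), sym 3 (canonKey [2, 0, 2])], -1)]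
        [(monoKey [sym 1 (canonKey [2, 0, 2]), sym 3 (canonKey [2, 3, 0, 2, 3])], 1)] ∧
    rowResidual 3 printedRows3 28 = [] ∧ closes 3 printedRows3 [26,
      27] = true ∧ closes 3 printedRows3 [26] = false := by
  refine ⟨?_, ?_, ?_, ?_, ?_⟩ <;> decide +kernel

/-- CLOSURE, 2 and 3 loops: every printed set closes. -/
theorem volkovSets_close_orders_4_6 :
    printedBlocks2.all (closes 2 printedRows2) = true ∧ printedBlocks3.all (closes 3 printedRows3) = true := by
  refine ⟨?_, ?_⟩ <;> decide +kernel

set_option maxHeartbeats 4000000 in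
set_option maxRecDepth 40000 in
/-- CLOSURE, 4 loops, in kernel-sized chunks: the 74-graph set (rows 1–74). -/
theorem volkovSets_close_order8_a : (printedMulti4.take 1).all (closes 4 printedRows4) = true := by
  decide +kernel

set_option maxHeartbeats 4000000 in
set_option maxRecDepth 40000 in
/-- chunk: printed sets 2–7. -/
theorem volkovSets_close_order8_b : ((printedMulti4.drop 1).take 6).all (closes 4 printedRows4) = true := by
  decide +kernel

set_option maxHeartbeats 4000000 in
set_option maxRecDepth 40000 in
/-- chunk: printed sets 8–14. -/
theorem volkovSets_close_order8_c : ((printedMulti4.drop 7).take 7).all (closes 4 printedRows4) = true := by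
  decide +kernel

set_option maxHeartbeats 4000000 in
set_option maxRecDepth 40000 in
/-- chunk: printed sets 15–23. -/
theorem volkovSets_close_order8_d : ((printedMulti4.drop 14).take 9).all (closes 4 printedRows4) = true := by
  decide +kernel

set_option maxHeartbeats 4000000 in
set_option maxRecDepth 40000 in
/-- chunk: printed sets 24–35. -/
theorem volkovSets_close_order8_e : ((printedMulti4.drop 23).take 12).all (closes 4 printedRows4) = true := by
  decide +kernel

set_option maxHeartbeats 4000000 in
set_option maxRecDepth 40000 in
/-- chunk: printed sets 36–42. -/
theorem volkovSets_close_order8_f : ((printedMulti4.drop 35).take 7).all (closes 4 printedRows4) = true := by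
  decide +kernel

set_option maxHeartbeats 4000000 in
set_option maxRecDepth 40000 in
/-- chunk: the starred rows, first 18. -/
theorem volkovSets_close_order8_g : ((printedStarred4.take 18).map (fun i => [i])).all (closes 4 printedRows4) = true := by
  decide +kernel

set_option maxHeartbeats 4000000 in
set_option maxRecDepth 40000 in
/-- chunk: the starred rows, last 18. -/
theorem volkovSets_close_order8_h : ((printedStarred4.drop 18).map (fun i => [i])).all (closes 4 printedRows4) = true := by
  decide +kernel

/-- CLOSURE, 4 loops: every one of the 78 printed sets closes. -/
theorem volkovSets_close_order8 : printedBlocks4.all (closes 4 printedRows4) = true := by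
  have h : printedBlocks4 = (printedMulti4.take 1 ++ ((printedMulti4.drop 1).take 6 ++ ((printedMulti4.drop 7).take 7 ++
      ((printedMulti4.drop 14).take 9 ++ ((printedMulti4.drop 23).take 12 ++ (printedMulti4.drop 35).take 7))))) ++
      ((printedStarred4.take 18).map (fun i => [i]) ++ (printedStarred4.drop 18).map (fun i => [i])) := by
    decide
  rw [h, List.all_append, List.all_append, List.all_append, List.all_append, List.all_append, List.all_append,
    List.all_append, volkovSets_close_order8_a, volkovSets_close_order8_b, volkovSets_close_order8_c, volkovSets_close_order8_d,
    volkovSets_close_order8_e, volkovSets_close_order8_f, volkovSets_close_order8_g, volkovSets_close_order8_h]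
  decide

end Summit.Ventures.QEDPrecision.Diagrams
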